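/-
Origin: expansion seat `planner-pub-hodgecm-pv09-g3-0`, handover #1 2026-08-18T05:22:30Z (`HOME/pub-hodgecm-pv09-g3/lean/Pv09g3/PureTensorChar.lean`, md5 d398e249, 513 lines);
landed by the gen-6 packager in gate run 23 as `HodgeCM/PerL34/PureTensorChar.lean` (verbatim).
-/
/-
Copyright: HodgeCM publication cell (pub-hodgecm), DAG node N31, seam (I) (prover pv09, generation 3).
Released under the package licence.

# N31 seam (I), the `χ′`-half in KERNEL: a unitary character of a restricted product that is
# trivial on a box subgroup IS a pure tensor; pv11's `hf` reduces to the factorisation of the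
# matrix coefficient `y ↦ ⟨φ, ω(y)φ⟩` alone

Source under adjudication (NOT cited as a fact; this file PROVES a typed piece of its seam):
PerL v5 = `inputs/2001/summits__hodge-w-picard-modular-quadrilinear-period-galois-
closure__free__y1__paper__paper.tex`, Lemma 4.2(b), proof, tex ll. 608–609, verbatim:

  608: ... $=\int_{\U(W_i)(\A)}\langle\omega(y)\varphi,\varphi\rangle\,\chi'(y)\,dy$.
  609: For $\varphi=\otimes\varphi_v$ the last integral is $\prod_v I_v(\varphi_v)$ ...

and ll. 623–626 (the character `χ′` is unramified at almost all places — KERNEL since gate run 18,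
pv10 `HodgeCM.PerL34.NoSmallSubgroups`).

## Position in the DAG / what this file does

pv11's LANDED `AdelicFactorisation.RestrictedProductMeasureDatum.hEuler_of_pureTensor` PRODUCES the
`hEuler` binder of pv09's N31e `RallisIP.rallis_field_of_N31e'` from five inputs, the first of
which is the DICTIONARY hypothesis (SETUP D5)

  `hf : D.IsPureTensor T (fun y => ⟪φ, ω y φ⟫ * χ′ y) fl`

("ω = ⊗′ω_v, φ = ⊗φ_v, χ′ = ∏χ′_v, χ′_v|_{K_v} = 1 off T"); GAPS `pv11-A2` / `pv09g2-A1` record it as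
the honest residue (b) of seam (I).  This file splits `hf` into its two factors and PROVES the
`χ′`-factor outright:

* §1 `IsPureTensor.mul` / `.mono` / `.one` / `.congr`: pure tensors (over ANY datum) form a monoid
  under pointwise product, local factors multiplying — so `hf` for `⟪φ, ω y φ⟫ · χ′(y)` follows from
  `IsPureTensor` of EACH factor;
* §2 `map_eq_prod_map_mulSingle`: a homomorphism from a FINITE product of (possibly
  non-commutative) monoids to a commutative monoid is the product of its restrictions to the
  factors (via Mathlib's `Finset.noncommProd_mulSingle`);
* §3 `IsCoordinate D`: the propositional statement that the gluing maps `e_S` of a datum `D` over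
  Mathlib's `Πʳ i, [G i, K i]` are COORDINATE maps (`(e_S x)_i = x_i` on `S`, `∈ K_i` off `S`) —
  PROVED for every datum constructed in this package (`isCoordinate_ofLocal`, `_ofHaar`, `_ofEq`,
  `_ofLeftInvariant`; pv09-g2, gate run 22);
* §4 `extendOne B S : G_S →* Πʳ i, [G i, B i]` and **`IsCoordinate.isPureTensor_char`**: for such
  `D` and ANY monoid homomorphism `χ : Πʳ i, [G i, B i] →* ℂ` trivial on the box subgroup
  `∏_{i∉T} B_i × ∏_{i∈T} {1}` (pv10 `RestrictedProduct.boxSubgroup B T`), `χ` IS a pure tensor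
  with local factors `χ_i = χ ∘ (inclusion at i)`:
  `D.IsPureTensor T χ (fun i g => χ (RestrictedProduct.mulSingle B i g))`
  (proof: `e_S x = extendOne(x|_S) · k` with `k ∈ K_S ≤ K_T`, then §2 on `χ ∘ extendOne`);
* §5 `exists_boxSubgroup_le_ker` (pv10, ll. 623–626, repackaged), `continuous_mulSingle`,
  **`IsCoordinate.isPureTensor_unitaryChar`**: a CONTINUOUS unitary character
  `χ : Πʳ i, [G i, B i] →* Circle` (all `B i` OPEN subgroups) is trivial on some box subgroup,
  hence is a pure tensor for some finite `T`, with continuous local components;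
* §6 **`hEuler_of_coeffTensor`** (+ `_of_continuous`) / **`rallis_field_of_coeffTensor`**: pv11's
  `hEuler_of_pureTensor` / `rallis_field_of_pureTensor` with the binder `hf` REPLACED by
  `hc : D.IsPureTensor T (fun y => ⟪φ, ω y φ⟫) cl` — the factorisation of the matrix coefficient
  ALONE — and a unitary character `χ′` trivial on a box subgroup (resp. merely continuous); the
  local factors become `cl i g * χ′_i g`, and since `‖χ′_i‖ = 1` the local `L¹` data `hfl` / `hB`
  are those of `cl` (`integrable_mul_of_norm_le_one`, `norm_mul_coe_circle`);
  `aestronglyMeasurable_coeff_mul_char`: the `hfm` binder from continuity of the orbit map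
  `y ↦ ω(y)φ` and of `χ′` (Borel agreement `RestrictedMeasure.borelSpace`, pv09-g2).

RESIDUAL after this file (honest; unchanged in kind, smaller in extent): the pure-tensor
factorisation over the finite levels `A_S` of the matrix coefficient `y ↦ ⟪φ, ω(y)φ⟫` itself — i.e.
the restricted tensor product structure `ω = ⊗′ω_v` on `φ = ⊗φ_v` (SETUP D4/D5: the adelic Weil
representation is posited, not constructed, in this package), the continuity of the orbit map,
and the local `L¹` data / values of `cl` (pv07/pv13 inputs).  Everything about `χ′` in `hf` is
now KERNEL.

No internally-minted statement is cited; no hypothesis of this file names PerL, QW8 or a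
2001-programme claim.  Imports: Mathlib + LANDED `HodgeCM.PerL34.*` only; axioms = the standard trio.
Unit `pub-hodgecm-pv09-g3` (DAG-node prover #09, generation 3), 2026-08-18.
-/
import Summits.HodgeConjecture.HodgeCM.PerL34.RestrictedMeasureBorel_2
import Summits.HodgeConjecture.HodgeCM.PerL34.NoSmallSubgroups

set_option autoImplicit false

noncomputable section

open MeasureTheory Set Filter Function Topology

open scoped RestrictedProduct

/-! ## §1 Algebra of pure tensors over an arbitrary datum -/

namespace HodgeCM.PerL34.AdelicFactorisation.RestrictedProductMeasureDatum.IsPureTensor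

universe u v w

variable {ι : Type u} {G : ι → Type v} [∀ i, MeasurableSpace (G i)] {A : Type w} [MeasurableSpace A]
  {D : RestrictedProductMeasureDatum ι G A} {T T' : Finset ι} {f g : A → ℂ} {fl gl : ∀ i, G i → ℂ}

/-- Enlarging the exceptional finite set. -/
theorem mono (h : D.IsPureTensor T f fl) (hT : T ⊆ T') : D.IsPureTensor T' f fl :=
  fun S hS x => h S (hT.trans hS) x

/-- Pure tensors are closed under pointwise product; the local factors multiply. -/
theorem mul [DecidableEq ι] (hf : D.IsPureTensor T f fl) (hg : D.IsPureTensor T' g gl) :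
    D.IsPureTensor (T ∪ T') (fun a => f a * g a) (fun i x => fl i x * gl i x) :=
  fun S hS x => by
    show f (D.e S x) * g (D.e S x) = ∏ i : ↥S, fl i.1 (x.1 i) * gl i.1 (x.1 i)
    rw [hf S (Finset.subset_union_left.trans hS) x, hg S (Finset.subset_union_right.trans hS) x,
      ← Finset.prod_mul_distrib]

/-- The constant function `1` is the empty pure tensor. -/
theorem one : D.IsPureTensor ∅ (fun _ => 1) (fun _ _ => 1) :=
  fun S _ x => by simp

/-- Pointwise change of the global function and of the local factors. -/
theorem congr (h : D.IsPureTensor T f fl) (hfg : ∀ a, f a = g a) (hl : ∀ i x, fl i x = gl i x) :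
    D.IsPureTensor T g gl :=
  fun S hS x => by
    rw [← hfg, h S hS x]
    exact Finset.prod_congr rfl fun i _ => hl i.1 (x.1 i)

end HodgeCM.PerL34.AdelicFactorisation.RestrictedProductMeasureDatum.IsPureTensor

namespace HodgeCM.PerL34.PureTensor

open HodgeCM.PerL34.AdelicFactorisation HodgeCM.PerL34.RestrictedMeasure
  HodgeCM.PerL34.NoSmallSubgroups

universe u v

/-! ## §2 Homomorphisms out of a finite product of monoids -/

/-- A homomorphism from a FINITE product of monoids to a commutative monoid is the product of its
restrictions to the factors: `ψ y = ∏ i, ψ (mulSingle i (y i))` (the factors need not commute in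
the source; their images do). -/
theorem map_eq_prod_map_mulSingle {κ : Type*} [Fintype κ] [DecidableEq κ] {M : κ → Type*}
    [∀ i, Monoid (M i)] {N : Type*} [CommMonoid N] (ψ : (∀ i, M i) →* N) (y : ∀ i, M i) :
    ψ y = ∏ i, ψ (Pi.mulSingle i (y i)) := by
  conv_lhs => rw [← Finset.noncommProd_mulSingle y]
  rw [Finset.map_noncommProd]
  exact Finset.noncommProd_eq_prod _ _

/-! ## §3 Coordinate gluing maps -/

section coordinate

variable {ι : Type u} {G : ι → Type v} [∀ i, MeasurableSpace (G i)] {K : ∀ i, Set (G i)}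

/-- The gluing maps `e_S : G_S × C_S → A` of a restricted product measure datum `D` over Mathlib's
`Πʳ i, [G i, K i]` are COORDINATE maps: on `S` they read off the `G_S`-coordinates, off `S` they
land in `K_i`.  All data constructed in this package satisfy it (`isCoordinate_ofLocal` & co.). -/
structure IsCoordinate (D : RestrictedProductMeasureDatum ι G (Πʳ i, [G i, K i])) : Prop where
  apply_of_mem : ∀ (S : Finset ι) (x : ((i : ↥S) → G i) × D.C S) {i : ι} (hi : i ∈ S),
    D.e S x i = x.1 ⟨i, hi⟩
  apply_of_not_mem : ∀ (S : Finset ι) (x : ((i : ↥S) → G i) × D.C S) {i : ι}, i ∉ S →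
    D.e S x i ∈ K i

variable [Countable ι] (K) (ν : ∀ i, Measure (G i)) [∀ i, SigmaFinite (ν i)] (S₀ : Finset ι)
  (hKm : ∀ i, MeasurableSet (K i)) (hKne : ∀ i, (K i).Nonempty)
  (hK1 : ∀ i, i ∉ S₀ → ν i (K i) = 1)

/-- The datum `ofLocal` (pv09-g2: Leahy Prop. 3.1.8 as a kernel construction) has coordinate
gluing maps. -/
theorem isCoordinate_ofLocal :
    IsCoordinate (RestrictedProductMeasureDatum.ofLocal K ν S₀ hKm hKne hK1) where
  apply_of_mem S x _ hi := glue_apply_of_mem K S x hi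
  apply_of_not_mem S x i hi := by
    show glue K S x i ∈ K i
    rw [glue_apply_of_not_mem K S x hi]
    exact (x.2 ⟨i, hi⟩).2

end coordinate

section coordinateGroup

variable {ι : Type u} {G : ι → Type v} [∀ i, Group (G i)] [∀ i, TopologicalSpace (G i)]
  [∀ i, MeasurableSpace (G i)] [Countable ι]

/-- The Haar datum `ofHaar` (pv09-g2) has coordinate gluing maps. -/
theorem isCoordinate_ofHaar [∀ i, IsTopologicalGroup (G i)] [∀ i, T2Space (G i)]
    [∀ i, SecondCountableTopology (G i)] [∀ i, BorelSpace (G i)]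
    (C : ∀ i, TopologicalSpace.PositiveCompacts (G i)) (S₀ : Finset ι) :
    IsCoordinate (RestrictedProductMeasureDatum.ofHaar C S₀) :=
  isCoordinate_ofLocal _ _ _ _ _ _

/-- The datum `ofEq` (pv09-g2: measure field an arbitrary measure known to be a rescaled
restricted product measure) has coordinate gluing maps. -/
theorem isCoordinate_ofEq [DecidableEq ι] (B : ∀ i, Subgroup (G i))
    [hBo : Fact (∀ i, IsOpen (B i : Set (G i)))] [∀ i, OpensMeasurableSpace (G i)] (S₀ : Finset ι)
    (ν : ∀ i, Measure (G i)) [∀ i, SigmaFinite (ν i)] (c : NNReal) {i₀ : ι} (hi₀ : i₀ ∈ S₀)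
    (hB1 : ∀ i, i ∉ S₀ → ν i (B i : Set (G i)) = 1) (μ' : Measure (Πʳ i, [G i, B i]))
    (hμ : μ' = RestrictedMeasure.rpMeasure (fun i => (B i : Set (G i)))
      (Function.update ν i₀ (c • ν i₀)) S₀) :
    IsCoordinate (RestrictedProductMeasureDatum.ofEq B S₀ ν c hi₀ hB1 μ' hμ) where
  apply_of_mem S x _ hi := glue_apply_of_mem (fun i => (B i : Set (G i))) S x hi
  apply_of_not_mem S x i hi := by
    show glue (fun i => (B i : Set (G i))) S x i ∈ (B i : Set (G i))
    rw [glue_apply_of_not_mem (fun i => (B i : Set (G i))) S x hi]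
    exact (x.2 ⟨i, hi⟩).2

/-- The datum `ofLeftInvariant` (pv09-g2: measure field ANY σ-finite left-invariant measure on the
restricted product group, e.g. a paper's own Haar measure) has coordinate gluing maps. -/
theorem isCoordinate_ofLeftInvariant [∀ i, IsTopologicalGroup (G i)] [∀ i, T2Space (G i)]
    [∀ i, SecondCountableTopology (G i)] [∀ i, BorelSpace (G i)] [DecidableEq ι]
    (B : ∀ i, Subgroup (G i)) [hBo : Fact (∀ i, IsOpen (B i : Set (G i)))] (S₀ : Finset ι)
    (C : ∀ i, TopologicalSpace.PositiveCompacts (G i)) (ν : ∀ i, Measure (G i))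
    [∀ i, SigmaFinite (ν i)] [∀ i, (ν i).IsHaarMeasure]
    (hBc : ∀ i, i ∉ S₀ → IsCompact (B i : Set (G i)))
    (hB1 : ∀ i, i ∉ S₀ → ν i (B i : Set (G i)) = 1) {i₀ : ι} (hi₀ : i₀ ∈ S₀)
    (μ' : Measure (Πʳ i, [G i, B i])) [SigmaFinite μ'] [μ'.IsMulLeftInvariant] :
    IsCoordinate (RestrictedProductMeasureDatum.ofLeftInvariant B S₀ C ν hBc hB1 hi₀ μ') :=
  isCoordinate_ofEq _ _ _ _ _ _ _ _

end coordinateGroup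

/-! ## §4 Characters trivial on a box subgroup are pure tensors -/

section char

variable {ι : Type u} {G : ι → Type v} [∀ i, Group (G i)] [DecidableEq ι]
  {Sub : ι → Type*} [∀ i, SetLike (Sub i) (G i)] [∀ i, SubgroupClass (Sub i) (G i)]
  (B : ∀ i, Sub i)

/-- `G_S = Π_{i∈S} G_i →* Πʳ i, [G i, B i]`, `y ↦ (y on S, 1 off S)`. -/
def extendOne (S : Finset ι) : ((i : ↥S) → G i) →* Πʳ i, [G i, B i] where
  toFun y := RestrictedProduct.mk (fun i => if h : i ∈ S then y ⟨i, h⟩ else 1)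
    (Filter.eventually_of_mem S.finite_toSet.compl_mem_cofinite fun i hi => by
      have hi' : i ∉ S := fun h => hi (Finset.mem_coe.2 h)
      simp only [dif_neg hi']
      exact one_mem (B i))
  map_one' := RestrictedProduct.ext _ _ fun i => by
    show (if h : i ∈ S then (1 : (j : ↥S) → G j) ⟨i, h⟩ else (1 : G i)) = (1 : G i)
    split_ifs <;> rfl
  map_mul' y z := RestrictedProduct.ext _ _ fun i => by
    show (if h : i ∈ S then (y * z) ⟨i, h⟩ else (1 : G i)) =
      (if h : i ∈ S then y ⟨i, h⟩ else (1 : G i)) * (if h : i ∈ S then z ⟨i, h⟩ else (1 : G i))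
    split_ifs with h
    · rfl
    · exact (mul_one _).symm

/-- (Ported verbatim from the HodgeCMPerL package; no docstring in the source.) -/
theorem extendOne_apply_of_mem (S : Finset ι) (y : (i : ↥S) → G i) {i : ι} (hi : i ∈ S) :
    extendOne B S y i = y ⟨i, hi⟩ :=
  dif_pos hi

/-- (Ported verbatim from the HodgeCMPerL package; no docstring in the source.) -/
theorem extendOne_apply_of_not_mem (S : Finset ι) (y : (i : ↥S) → G i) {i : ι} (hi : i ∉ S) :
    extendOne B S y i = 1 :=
  dif_neg hi

/-- `extendOne` maps the `i`-th basic element of `G_S` to the `i`-th basic element of the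
restricted product. -/
theorem extendOne_mulSingle (S : Finset ι) (i : ↥S) (g : G i) :
    extendOne B S (Pi.mulSingle i g) = RestrictedProduct.mulSingle B (i : ι) g :=
  RestrictedProduct.ext _ _ fun j => by
    show (if h : j ∈ S then (Pi.mulSingle i g : (k : ↥S) → G k) ⟨j, h⟩ else 1) =
      Pi.mulSingle (i : ι) g j
    by_cases hj : j ∈ S
    · rw [dif_pos hj]
      by_cases hji : (⟨j, hj⟩ : ↥S) = i
      · subst hji
        rw [Pi.mulSingle_eq_same, Pi.mulSingle_eq_same]
      · rw [Pi.mulSingle_eq_of_ne hji, Pi.mulSingle_eq_of_ne (fun h => hji (Subtype.ext h))]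
    · rw [dif_neg hj, Pi.mulSingle_eq_of_ne]
      rintro rfl
      exact hj i.2

omit [DecidableEq ι] in
/-- The box subgroups decrease as the exceptional set grows. -/
theorem boxSubgroup_antitone {T S : Finset ι} (h : T ⊆ S) :
    RestrictedProduct.boxSubgroup B S ≤ RestrictedProduct.boxSubgroup B T :=
  fun x hx => (RestrictedProduct.mem_boxSubgroup_iff T x).2
    ⟨((RestrictedProduct.mem_boxSubgroup_iff S x).1 hx).1,
      fun i hi => ((RestrictedProduct.mem_boxSubgroup_iff S x).1 hx).2 i (h hi)⟩

/-- A point of the restricted product whose coordinates off `S` lie in the `B i` differs from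
`extendOne` of its `S`-coordinates by an element of the box subgroup `K_S`. -/
theorem extendOne_inv_mul_mem_boxSubgroup (S : Finset ι) (y : (i : ↥S) → G i)
    (a : Πʳ i, [G i, B i]) (hS : ∀ (i : ι) (hi : i ∈ S), a i = y ⟨i, hi⟩)
    (hS' : ∀ i, i ∉ S → a i ∈ B i) :
    (extendOne B S y)⁻¹ * a ∈ RestrictedProduct.boxSubgroup B S := by
  rw [RestrictedProduct.mem_boxSubgroup_iff]
  refine ⟨fun i => ?_, fun i hi => ?_⟩
  · rw [RestrictedProduct.mul_apply, RestrictedProduct.inv_apply]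
    by_cases hi : i ∈ S
    · rw [extendOne_apply_of_mem B S y hi, ← hS i hi, inv_mul_cancel]
      exact one_mem _
    · rw [extendOne_apply_of_not_mem B S y hi, inv_one, one_mul]
      exact hS' i hi
  · rw [RestrictedProduct.mul_apply, RestrictedProduct.inv_apply, extendOne_apply_of_mem B S y hi,
      ← hS i hi, inv_mul_cancel]

variable [∀ i, MeasurableSpace (G i)]

/-- **A character trivial on a box subgroup is a pure tensor.**  Let `D` be a restricted product
measure datum over `Πʳ i, [G i, B i]` with coordinate gluing maps, and `χ : Πʳ i, [G i, B i] →* ℂ`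
a multiplicative map trivial on `K_T = ∏_{i∉T} B_i × ∏_{i∈T} {1}`.  Then on every level `A_S`,
`S ⊇ T`, `χ` is the product over `S` of its local components `χ_i = χ ∘ (inclusion at i)`:
`χ(e_S x) = ∏_{i∈S} χ_i(x_i)` — i.e. `χ = ⊗_i χ_i` in the sense of pv11's `IsPureTensor`. -/
theorem IsCoordinate.isPureTensor_char
    {D : RestrictedProductMeasureDatum ι G (Πʳ i, [G i, B i])} (hD : IsCoordinate D)
    (χ : (Πʳ i, [G i, B i]) →* ℂ) {T : Finset ι}
    (hχ : ∀ k ∈ RestrictedProduct.boxSubgroup B T, χ k = 1) :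
    D.IsPureTensor T χ (fun i g => χ (RestrictedProduct.mulSingle B i g)) := by
  intro S hTS x
  have hk : (extendOne B S x.1)⁻¹ * D.e S x ∈ RestrictedProduct.boxSubgroup B T :=
    boxSubgroup_antitone B hTS (extendOne_inv_mul_mem_boxSubgroup B S x.1 (D.e S x)
      (fun _ hi => hD.apply_of_mem S x hi) (fun _ hi => hD.apply_of_not_mem S x hi))
  calc χ (D.e S x) = χ (extendOne B S x.1 * ((extendOne B S x.1)⁻¹ * D.e S x)) := by
        rw [mul_inv_cancel_left]
    _ = χ (extendOne B S x.1) := by rw [map_mul, hχ _ hk, mul_one]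
    _ = ∏ i : ↥S, (χ.comp (extendOne B S)) (Pi.mulSingle i (x.1 i)) :=
        map_eq_prod_map_mulSingle (χ.comp (extendOne B S)) x.1
    _ = ∏ i : ↥S, χ (RestrictedProduct.mulSingle B (i : ι) (x.1 i)) :=
        Finset.prod_congr rfl fun i _ => by rw [MonoidHom.comp_apply, extendOne_mulSingle]

/-- `Circle`-valued version: a unitary character trivial on the box subgroup `K_T` is a pure
tensor (viewed in `ℂ`), with local factors its local components. -/
theorem IsCoordinate.isPureTensor_unitaryChar
    {D : RestrictedProductMeasureDatum ι G (Πʳ i, [G i, B i])} (hD : IsCoordinate D)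
    (χ : (Πʳ i, [G i, B i]) →* Circle) {T : Finset ι}
    (hχ : RestrictedProduct.boxSubgroup B T ≤ χ.ker) :
    D.IsPureTensor T (fun y => ((χ y : Circle) : ℂ))
      (fun i g => ((χ (RestrictedProduct.mulSingle B i g) : Circle) : ℂ)) :=
  (hD.isPureTensor_char B (Circle.coeHom.comp χ) fun k hk => by
      rw [MonoidHom.comp_apply, MonoidHom.mem_ker.1 (hχ hk), map_one]).congr
    (fun _ => rfl) (fun _ _ => rfl)

end char

/-! ## §5 Continuous unitary characters (pv10, PerL v5 ll. 623–626, repackaged) -/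

section continuous

variable {ι : Type u} {G : ι → Type v} [∀ i, Group (G i)] [∀ i, TopologicalSpace (G i)]
  [DecidableEq ι] {Sub : ι → Type*} [∀ i, SetLike (Sub i) (G i)] [∀ i, SubgroupClass (Sub i) (G i)]
  (B : ∀ i, Sub i)

omit [DecidableEq ι] in
/-- **PerL v5 ll. 623–626 as one statement**: a continuous unitary character of a restricted
product with respect to OPEN subgroups is trivial on a box subgroup `∏_{i∉T} B_i × ∏_{i∈T} {1}`
(the circle has no small subgroups — pv10 `exists_nhds_one_forall_subgroup_le_ker` — and
neighbourhoods of `1` contain box subgroups — pv10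
`RestrictedProduct.exists_finset_forall_mem_of_nhds_one`). -/
theorem exists_boxSubgroup_le_ker (hBopen : ∀ i, IsOpen (B i : Set (G i)))
    (χ : (Πʳ i, [G i, B i]) →* Circle) (hχ : Continuous χ) :
    ∃ T : Finset ι, RestrictedProduct.boxSubgroup B T ≤ χ.ker := by
  obtain ⟨U, hU, hker⟩ := exists_nhds_one_forall_subgroup_le_ker χ hχ
  obtain ⟨T, hT⟩ := RestrictedProduct.exists_finset_forall_mem_of_nhds_one hBopen hU
  exact ⟨T, hker _ fun x hx =>
    hT x ((RestrictedProduct.mem_boxSubgroup_iff T x).1 hx).1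
      ((RestrictedProduct.mem_boxSubgroup_iff T x).1 hx).2⟩

/-- The local inclusion `G_i → Πʳ j, [G j, B j]` at `i` is continuous (it factors through the
principal level `{i}ᶜ`, which carries the product topology). -/
theorem continuous_mulSingle (i : ι) :
    Continuous (RestrictedProduct.mulSingle B i : G i → Πʳ j, [G j, B j]) := by
  have hS : (cofinite : Filter ι) ≤ 𝓟 ({i}ᶜ : Set ι) :=
    le_principal_iff.2 (by rw [mem_cofinite, compl_compl]; exact Set.finite_singleton i)
  let m : G i → Πʳ j, [G j, B j]_[𝓟 ({i}ᶜ : Set ι)] := fun g =>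
    ⟨Pi.mulSingle i g, by
      rw [Filter.eventually_principal]
      intro j hj
      rw [Pi.mulSingle_eq_of_ne (fun h : j = i => hj (Set.mem_singleton_iff.2 h)) g]
      exact one_mem (B j)⟩
  have hm : Continuous m :=
    RestrictedProduct.continuous_rng_of_principal.2 (_root_.continuous_mulSingle i)
  have hfac : (RestrictedProduct.mulSingle B i : G i → Πʳ j, [G j, B j]) =
      RestrictedProduct.inclusion (fun j => G j) (fun j => (B j : Set (G j))) hS ∘ m := by
    funext g
    exact RestrictedProduct.ext _ _ fun j => rfl
  rw [hfac]
  exact (RestrictedProduct.continuous_inclusion hS).comp hm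

/-- The local component `χ_i = χ ∘ (inclusion at i)` of a continuous character is continuous. -/
theorem continuous_localComponent (χ : (Πʳ i, [G i, B i]) →* Circle)
    (hχ : Continuous χ) (i : ι) :
    Continuous fun g : G i => ((χ (RestrictedProduct.mulSingle B i g) : Circle) : ℂ) :=
  continuous_subtype_val.comp (hχ.comp (continuous_mulSingle B i))

variable [∀ i, MeasurableSpace (G i)]

/-- **A continuous unitary character is a pure tensor**: for a datum with coordinate gluing maps
over `Πʳ i, [G i, B i]` (`B i` open subgroups) and a continuous `χ : Πʳ i, [G i, B i] →* Circle`,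
there is a finite `T` with `χ = ⊗_i χ_i`, `χ_i|_{B_i} = 1` off `T`, in the sense of `IsPureTensor`. -/
theorem IsCoordinate.exists_isPureTensor_unitaryChar
    (hBopen : ∀ i, IsOpen (B i : Set (G i)))
    {D : RestrictedProductMeasureDatum ι G (Πʳ i, [G i, B i])} (hD : IsCoordinate D)
    (χ : (Πʳ i, [G i, B i]) →* Circle) (hχ : Continuous χ) :
    ∃ T : Finset ι, D.IsPureTensor T (fun y => ((χ y : Circle) : ℂ))
      (fun i g => ((χ (RestrictedProduct.mulSingle B i g) : Circle) : ℂ)) := by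
  obtain ⟨T, hT⟩ := exists_boxSubgroup_le_ker B hBopen χ hχ
  exact ⟨T, hD.isPureTensor_unitaryChar B χ hT⟩

end continuous

/-! ## §6 The N31 seam: `hf` from the factorisation of the matrix coefficient alone -/


-- port_pkg: scope closed for this part
end HodgeCM.PerL34.PureTensor
end
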